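import Summits.ValiantsHypothesis.ValiantsHypothesis.Theorems.LacunarySymmetroidMatrixDescartesPivotResolventSlope
import Summits.ValiantsHypothesis.ValiantsHypothesis.Theorems.LacunarySymmetroidMatrixDescartesPivotRankOneResolventPairForm

/-!
# `MatrixDescartes` census — rank-one `(2,4)₁`: the TILTS `τ_e`, `π_e` of the four-letter pencil and the REGIME LAW on the `1|3` split
# (turning points of the resolvent profile lie outside the interval between the zeros of `τ_e` and `π_e`)

HONEST FRAMING.  Object-search cell `pub-symmetroid`, seat `val-sym-mdr-p1` (generation 18); helper file `--supports` the crux item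
stmt-ValiantsHypothesis-18050 (`Theses.LacunarySymmetroid.MatrixDescartes`, OPEN, on HOLD) with NO closure claim.  Companion of
`…PivotResolventSlope` (slope `(R/x^e)′ = (Rτ_e + π_e)/(Sx^{e+1})`, middle-range law) and `…PivotRankOneResolventPairForm` (moment
polynomials).  For the rank-one four-letter pencil `X^e J + ∑ wₖX^{dₖ}vₖvₖᵀ` with general symmetric `J` this file computes the two TILTS in
letter terms (§1): `τ_e(x) = xτ′ − eτ = ∑ₖ (dₖ − e) wₖ mₖ x^{dₖ}`, `mₖ = J₀₀vₖ₁² − 2J₀₁vₖ₀vₖ₁ + J₁₁vₖ₀² = m(J, vₖ)` (the letter cores), and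
`π_e(x) = xπ′ − 2eπ = ∑_{k<l} (dₖ + d_l − 2e) wₖw_l D_{kl}² x^{dₖ+d_l}` (the tilt of the pair posynomial `π = det G`).  On the `1|3` split
(`d₀ < e < d₁ ≤ d₂ ≤ d₃`) with CORE letters (`mₖ ≤ 0` for `k ≥ 1`) `τ_e/x^{d₀}` is nonincreasing, and when `d₀ + d₁ ≤ 2e ≤ d₀ + d₂` (the first two
chamber-(C) inequalities) `π_e/x^{d₀+d₁}` is nondecreasing (§2): so `τ_e ≤ 0` and `π_e > 0` propagate to the right, `τ_e ≥ 0` and `π_e < 0`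
to the left.  **REGIME LAW** (§3, `resolventProfile_strictAntiOn_of_ends` / `_strictMonoOn_of_ends`): for `0 < a < b`, if `τ_e(a) ≤ 0` and
`π_e(b) < 0` the resolvent profile is strictly DECREASING on `[a, b]`; if `π_e(a) > 0` and `τ_e(b) ≥ 0` it is strictly INCREASING on `[a, b]`
— in chamber (C) the profile is monotone between the zero of `τ_e` and the zero of `π_e`, and all its turning points lie in the two outer
ranges (located ≤ 2 + ≤ 3; the count — hence «(C) ≤ 8» — stays OPEN).  Nothing here bears on `MatrixDescartes` in its window, on `DoorA26` /
`DoorA34`, registers / credences, or `VP ≠ VNP`.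

[folklore] Elementary; the tree lemmas named above.  No definitions, no named facts.
-/

-- `Summit.ValiantsHypothesis.ValiantsHypothesis.…` repeats a component by the D-0017 layout
-- (single-conjunct summit), which the `dupNamespace` linter flags; the name is mandated.
set_option linter.dupNamespace false

namespace Summit.ValiantsHypothesis.ValiantsHypothesis.Theorems.LacunarySymmetroidMatrixDescartes.Pivot.Resolvent

open Polynomial Set
open scoped BigOperators

/-! ## 1. The tilts in letter terms -/

/-- **Tilted trace**: `x·τ′(x) − e·τ(x) = ∑ₖ (dₖ − e) wₖ mₖ x^{dₖ}`, `mₖ = J₀₀vₖ₁² − 2J₀₁vₖ₀vₖ₁ + J₁₁vₖ₀²`. [this file] -/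
theorem eval_tiltTrace (e d₀ d₁ d₂ d₃ : ℕ) (J : Matrix (Fin 2) (Fin 2) ℝ) (v₀ v₁ v₂ v₃ : Fin 2 → ℝ) (w₀ w₁ w₂ w₃ : ℝ)
    (𝔄 𝔘 ℭ τ π : ℝ[X])
    (h𝔄 : 𝔄 = Polynomial.C (w₀ * v₀ 0 ^ 2) * X ^ d₀ + Polynomial.C (w₁ * v₁ 0 ^ 2) * X ^ d₁ + Polynomial.C (w₂ * v₂ 0 ^ 2) * X ^ d₂
      + Polynomial.C (w₃ * v₃ 0 ^ 2) * X ^ d₃)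
    (h𝔘 : 𝔘 = Polynomial.C (w₀ * (v₀ 0 * v₀ 1)) * X ^ d₀ + Polynomial.C (w₁ * (v₁ 0 * v₁ 1)) * X ^ d₁
      + Polynomial.C (w₂ * (v₂ 0 * v₂ 1)) * X ^ d₂ + Polynomial.C (w₃ * (v₃ 0 * v₃ 1)) * X ^ d₃)
    (hℭ : ℭ = Polynomial.C (w₀ * v₀ 1 ^ 2) * X ^ d₀ + Polynomial.C (w₁ * v₁ 1 ^ 2) * X ^ d₁ + Polynomial.C (w₂ * v₂ 1 ^ 2) * X ^ d₂
      + Polynomial.C (w₃ * v₃ 1 ^ 2) * X ^ d₃)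
    (hτ : τ = Polynomial.C (J 0 0) * ℭ - Polynomial.C (2 * J 0 1) * 𝔘 + Polynomial.C (J 1 1) * 𝔄)
    (_hπ : π = 𝔄 * ℭ - 𝔘 ^ 2) (x : ℝ) :
    x * τ.derivative.eval x - e * τ.eval x = (((d₀ : ℝ) - e) * w₀ * (J 0 0 * v₀ 1 ^ 2 - 2 * J 0 1 * (v₀ 0 * v₀ 1) + J 1 1 * v₀ 0 ^ 2) * x ^ d₀ + ((d₁ : ℝ) - e) * w₁ * (J 0 0 * v₁ 1 ^ 2 - 2 * J 0 1 * (v₁ 0 * v₁ 1) + J 1 1 * v₁ 0 ^ 2) * x ^ d₁ + ((d₂ : ℝ) - e) * w₂ * (J 0 0 * v₂ 1 ^ 2 - 2 * J 0 1 * (v₂ 0 * v₂ 1) + J 1 1 * v₂ 0 ^ 2) * x ^ d₂ + ((d₃ : ℝ) - e) * w₃ * (J 0 0 * v₃ 1 ^ 2 - 2 * J 0 1 * (v₃ 0 * v₃ 1) + J 1 1 * v₃ 0 ^ 2) * x ^ d₃) := by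
  subst hτ
  simp only [derivative_add, derivative_sub, derivative_mul, derivative_C, zero_mul, zero_add, eval_add, eval_sub, eval_mul, eval_C]
  have dA := x_mul_eval_derivative_fourNomial (w₀ * v₀ 0 ^ 2) (w₁ * v₁ 0 ^ 2) (w₂ * v₂ 0 ^ 2) (w₃ * v₃ 0 ^ 2) x d₀ d₁ d₂ d₃
  have dU := x_mul_eval_derivative_fourNomial (w₀ * (v₀ 0 * v₀ 1)) (w₁ * (v₁ 0 * v₁ 1)) (w₂ * (v₂ 0 * v₂ 1)) (w₃ * (v₃ 0 * v₃ 1)) x d₀ d₁ d₂ d₃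
  have dC := x_mul_eval_derivative_fourNomial (w₀ * v₀ 1 ^ 2) (w₁ * v₁ 1 ^ 2) (w₂ * v₂ 1 ^ 2) (w₃ * v₃ 1 ^ 2) x d₀ d₁ d₂ d₃
  have eA := eval_fourNomial (w₀ * v₀ 0 ^ 2) (w₁ * v₁ 0 ^ 2) (w₂ * v₂ 0 ^ 2) (w₃ * v₃ 0 ^ 2) x d₀ d₁ d₂ d₃
  have eU := eval_fourNomial (w₀ * (v₀ 0 * v₀ 1)) (w₁ * (v₁ 0 * v₁ 1)) (w₂ * (v₂ 0 * v₂ 1)) (w₃ * (v₃ 0 * v₃ 1)) x d₀ d₁ d₂ d₃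
  have eC := eval_fourNomial (w₀ * v₀ 1 ^ 2) (w₁ * v₁ 1 ^ 2) (w₂ * v₂ 1 ^ 2) (w₃ * v₃ 1 ^ 2) x d₀ d₁ d₂ d₃
  rw [← h𝔄] at dA eA
  rw [← h𝔘] at dU eU
  rw [← hℭ] at dC eC
  have e1 : x * (J 0 0 * eval x (derivative ℭ) - 2 * J 0 1 * eval x (derivative 𝔘) + J 1 1 * eval x (derivative 𝔄))
      = J 0 0 * (x * eval x (derivative ℭ)) - 2 * J 0 1 * (x * eval x (derivative 𝔘)) + J 1 1 * (x * eval x (derivative 𝔄)) := by ring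
  rw [e1, dA, dU, dC, eA, eU, eC]
  ring

/-- **Tilted pair posynomial**: `x·π′(x) − 2e·π(x) = ∑_{k<l} (dₖ + d_l − 2e) wₖw_l D_{kl}² x^{dₖ+d_l}`. [this file] -/
theorem eval_tiltPair (e d₀ d₁ d₂ d₃ : ℕ) (J : Matrix (Fin 2) (Fin 2) ℝ) (v₀ v₁ v₂ v₃ : Fin 2 → ℝ) (w₀ w₁ w₂ w₃ : ℝ)
    (𝔄 𝔘 ℭ τ π : ℝ[X])
    (h𝔄 : 𝔄 = Polynomial.C (w₀ * v₀ 0 ^ 2) * X ^ d₀ + Polynomial.C (w₁ * v₁ 0 ^ 2) * X ^ d₁ + Polynomial.C (w₂ * v₂ 0 ^ 2) * X ^ d₂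
      + Polynomial.C (w₃ * v₃ 0 ^ 2) * X ^ d₃)
    (h𝔘 : 𝔘 = Polynomial.C (w₀ * (v₀ 0 * v₀ 1)) * X ^ d₀ + Polynomial.C (w₁ * (v₁ 0 * v₁ 1)) * X ^ d₁
      + Polynomial.C (w₂ * (v₂ 0 * v₂ 1)) * X ^ d₂ + Polynomial.C (w₃ * (v₃ 0 * v₃ 1)) * X ^ d₃)
    (hℭ : ℭ = Polynomial.C (w₀ * v₀ 1 ^ 2) * X ^ d₀ + Polynomial.C (w₁ * v₁ 1 ^ 2) * X ^ d₁ + Polynomial.C (w₂ * v₂ 1 ^ 2) * X ^ d₂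
      + Polynomial.C (w₃ * v₃ 1 ^ 2) * X ^ d₃)
    (_hτ : τ = Polynomial.C (J 0 0) * ℭ - Polynomial.C (2 * J 0 1) * 𝔘 + Polynomial.C (J 1 1) * 𝔄)
    (hπ : π = 𝔄 * ℭ - 𝔘 ^ 2) (x : ℝ) :
    x * π.derivative.eval x - 2 * e * π.eval x = (((d₀ : ℝ) + d₁ - 2 * e) * w₀ * w₁ * (v₀ 0 * v₁ 1 - v₀ 1 * v₁ 0) ^ 2 * x ^ (d₀ + d₁)
      + ((d₀ : ℝ) + d₂ - 2 * e) * w₀ * w₂ * (v₀ 0 * v₂ 1 - v₀ 1 * v₂ 0) ^ 2 * x ^ (d₀ + d₂)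
      + ((d₀ : ℝ) + d₃ - 2 * e) * w₀ * w₃ * (v₀ 0 * v₃ 1 - v₀ 1 * v₃ 0) ^ 2 * x ^ (d₀ + d₃)
      + ((d₁ : ℝ) + d₂ - 2 * e) * w₁ * w₂ * (v₁ 0 * v₂ 1 - v₁ 1 * v₂ 0) ^ 2 * x ^ (d₁ + d₂)
      + ((d₁ : ℝ) + d₃ - 2 * e) * w₁ * w₃ * (v₁ 0 * v₃ 1 - v₁ 1 * v₃ 0) ^ 2 * x ^ (d₁ + d₃)
      + ((d₂ : ℝ) + d₃ - 2 * e) * w₂ * w₃ * (v₂ 0 * v₃ 1 - v₂ 1 * v₃ 0) ^ 2 * x ^ (d₂ + d₃)) := by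
  subst hπ
  simp only [derivative_sub, derivative_mul, derivative_pow, eval_add, eval_sub, eval_mul, eval_pow, eval_C, Nat.cast_ofNat,
    Nat.add_one_sub_one, pow_one]
  have dA := x_mul_eval_derivative_fourNomial (w₀ * v₀ 0 ^ 2) (w₁ * v₁ 0 ^ 2) (w₂ * v₂ 0 ^ 2) (w₃ * v₃ 0 ^ 2) x d₀ d₁ d₂ d₃
  have dU := x_mul_eval_derivative_fourNomial (w₀ * (v₀ 0 * v₀ 1)) (w₁ * (v₁ 0 * v₁ 1)) (w₂ * (v₂ 0 * v₂ 1)) (w₃ * (v₃ 0 * v₃ 1)) x d₀ d₁ d₂ d₃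
  have dC := x_mul_eval_derivative_fourNomial (w₀ * v₀ 1 ^ 2) (w₁ * v₁ 1 ^ 2) (w₂ * v₂ 1 ^ 2) (w₃ * v₃ 1 ^ 2) x d₀ d₁ d₂ d₃
  have eA := eval_fourNomial (w₀ * v₀ 0 ^ 2) (w₁ * v₁ 0 ^ 2) (w₂ * v₂ 0 ^ 2) (w₃ * v₃ 0 ^ 2) x d₀ d₁ d₂ d₃
  have eU := eval_fourNomial (w₀ * (v₀ 0 * v₀ 1)) (w₁ * (v₁ 0 * v₁ 1)) (w₂ * (v₂ 0 * v₂ 1)) (w₃ * (v₃ 0 * v₃ 1)) x d₀ d₁ d₂ d₃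
  have eC := eval_fourNomial (w₀ * v₀ 1 ^ 2) (w₁ * v₁ 1 ^ 2) (w₂ * v₂ 1 ^ 2) (w₃ * v₃ 1 ^ 2) x d₀ d₁ d₂ d₃
  rw [← h𝔄] at dA eA
  rw [← h𝔘] at dU eU
  rw [← hℭ] at dC eC
  have e1 : x * (eval x (derivative 𝔄) * eval x ℭ + eval x 𝔄 * eval x (derivative ℭ) - 2 * eval x 𝔘 * eval x (derivative 𝔘))
      = (x * eval x (derivative 𝔄)) * eval x ℭ + eval x 𝔄 * (x * eval x (derivative ℭ)) - 2 * eval x 𝔘 * (x * eval x (derivative 𝔘)) := by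
    ring
  rw [e1, dA, dU, dC, eA, eU, eC]
  ring

/-! ## 2. One-sided propagation of the signs of the tilts on the `1|3` split -/

/-- **`τ_e/x^{d₀}` is nonincreasing** on `(0, ∞)` when `d₀ < e < d₁ ≤ d₂ ≤ d₃`, the upper letters are CORE (`mₖ ≤ 0`, `k ≥ 1`) and
their weights are `≥ 0` (the `k = 0` term is constant after the division; no hypothesis on `m₀`, `w₀`). [this file] -/
theorem tiltTrace_div_antitone (e d₀ d₁ d₂ d₃ : ℕ) (h0e : d₀ < e) (he1 : e < d₁) (h12 : d₁ ≤ d₂) (h23 : d₂ ≤ d₃)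
    (J : Matrix (Fin 2) (Fin 2) ℝ) (v₀ v₁ v₂ v₃ : Fin 2 → ℝ) (w₀ w₁ w₂ w₃ : ℝ) (hw₁ : 0 ≤ w₁) (hw₂ : 0 ≤ w₂) (hw₃ : 0 ≤ w₃)
    (hm₁ : J 0 0 * v₁ 1 ^ 2 - 2 * J 0 1 * (v₁ 0 * v₁ 1) + J 1 1 * v₁ 0 ^ 2 ≤ 0)
    (hm₂ : J 0 0 * v₂ 1 ^ 2 - 2 * J 0 1 * (v₂ 0 * v₂ 1) + J 1 1 * v₂ 0 ^ 2 ≤ 0)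
    (hm₃ : J 0 0 * v₃ 1 ^ 2 - 2 * J 0 1 * (v₃ 0 * v₃ 1) + J 1 1 * v₃ 0 ^ 2 ≤ 0) (x y : ℝ) (hx : 0 < x) (hxy : x ≤ y) :
    (((d₀ : ℝ) - e) * w₀ * (J 0 0 * v₀ 1 ^ 2 - 2 * J 0 1 * (v₀ 0 * v₀ 1) + J 1 1 * v₀ 0 ^ 2) * y ^ d₀ + ((d₁ : ℝ) - e) * w₁ * (J 0 0 * v₁ 1 ^ 2 - 2 * J 0 1 * (v₁ 0 * v₁ 1) + J 1 1 * v₁ 0 ^ 2) * y ^ d₁ + ((d₂ : ℝ) - e) * w₂ * (J 0 0 * v₂ 1 ^ 2 - 2 * J 0 1 * (v₂ 0 * v₂ 1) + J 1 1 * v₂ 0 ^ 2) * y ^ d₂ + ((d₃ : ℝ) - e) * w₃ * (J 0 0 * v₃ 1 ^ 2 - 2 * J 0 1 * (v₃ 0 * v₃ 1) + J 1 1 * v₃ 0 ^ 2) * y ^ d₃) / y ^ d₀ ≤ (((d₀ : ℝ) - e) * w₀ * (J 0 0 * v₀ 1 ^ 2 - 2 * J 0 1 * (v₀ 0 * v₀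 1) + J 1 1 * v₀ 0 ^ 2) * x ^ d₀ + ((d₁ : ℝ) - e) * w₁ * (J 0 0 * v₁ 1 ^ 2 - 2 * J 0 1 * (v₁ 0 * v₁ 1) + J 1 1 * v₁ 0 ^ 2) * x ^ d₁ + ((d₂ : ℝ) - e) * w₂ * (J 0 0 * v₂ 1 ^ 2 - 2 * J 0 1 * (v₂ 0 * v₂ 1) + J 1 1 * v₂ 0 ^ 2) * x ^ d₂ + ((d₃ : ℝ) - e) * w₃ * (J 0 0 * v₃ 1 ^ 2 - 2 * J 0 1 * (v₃ 0 * v₃ 1) + J 1 1 * v₃ 0 ^ 2) * x ^ d₃) / x ^ d₀ := by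
  have hy : 0 < y := lt_of_lt_of_le hx hxy
  have q : ∀ a : ℕ, d₀ ≤ a → x ^ a / x ^ d₀ ≤ y ^ a / y ^ d₀ := by
    intro a ha
    have key : ∀ z : ℝ, 0 < z → z ^ a / z ^ d₀ = z ^ (a - d₀) := by
      intro z hz
      have hz' : z ^ a = z ^ d₀ * z ^ (a - d₀) := by rw [← pow_add]; congr 1; omega
      rw [hz', mul_div_cancel_left₀ _ (pow_pos hz _).ne']
    rw [key x hx, key y hy]
    exact pow_le_pow_left₀ hx.le hxy _
  have q0 : ∀ z : ℝ, 0 < z → z ^ d₀ / z ^ d₀ = 1 := fun z hz => div_self (pow_pos hz _).ne'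
  have c1 : ((d₁ : ℝ) - e) * w₁ * (J 0 0 * v₁ 1 ^ 2 - 2 * J 0 1 * (v₁ 0 * v₁ 1) + J 1 1 * v₁ 0 ^ 2) ≤ 0 :=
    mul_nonpos_of_nonneg_of_nonpos (mul_nonneg (by exact_mod_cast (by omega : (0 : ℤ) ≤ (d₁ : ℤ) - e)) hw₁) hm₁
  have c2 : ((d₂ : ℝ) - e) * w₂ * (J 0 0 * v₂ 1 ^ 2 - 2 * J 0 1 * (v₂ 0 * v₂ 1) + J 1 1 * v₂ 0 ^ 2) ≤ 0 :=
    mul_nonpos_of_nonneg_of_nonpos (mul_nonneg (by exact_mod_cast (by omega : (0 : ℤ) ≤ (d₂ : ℤ) - e)) hw₂) hm₂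
  have c3 : ((d₃ : ℝ) - e) * w₃ * (J 0 0 * v₃ 1 ^ 2 - 2 * J 0 1 * (v₃ 0 * v₃ 1) + J 1 1 * v₃ 0 ^ 2) ≤ 0 :=
    mul_nonpos_of_nonneg_of_nonpos (mul_nonneg (by exact_mod_cast (by omega : (0 : ℤ) ≤ (d₃ : ℤ) - e)) hw₃) hm₃
  rw [add_div, add_div, add_div, add_div, add_div, add_div]
  simp only [mul_div_assoc]
  rw [q0 x hx, q0 y hy]
  have t1 := mul_le_mul_of_nonpos_left (q d₁ (by omega)) c1
  have t2 := mul_le_mul_of_nonpos_left (q d₂ (by omega)) c2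
  have t3 := mul_le_mul_of_nonpos_left (q d₃ (by omega)) c3
  linarith

/-- **`π_e/x^{d₀+d₁}` is nondecreasing** on `(0, ∞)` when `d₀ ≤ d₁ ≤ d₂ ≤ d₃` and `d₀ + d₁ ≤ 2e ≤ d₀ + d₂` (the coefficient of the lowest
pair `(0,1)` is the only non-positive one) and the weights are `≥ 0`. [this file] -/
theorem tiltPair_div_mono (e d₀ d₁ d₂ d₃ : ℕ) (h01 : d₀ ≤ d₁) (h12 : d₁ ≤ d₂) (h23 : d₂ ≤ d₃) (hlo : d₀ + d₁ ≤ 2 * e)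
    (hhi : 2 * e ≤ d₀ + d₂) (v₀ v₁ v₂ v₃ : Fin 2 → ℝ) (w₀ w₁ w₂ w₃ : ℝ) (hw₀ : 0 ≤ w₀) (hw₁ : 0 ≤ w₁) (hw₂ : 0 ≤ w₂) (hw₃ : 0 ≤ w₃)
    (x y : ℝ) (hx : 0 < x) (hxy : x ≤ y) :
    (((d₀ : ℝ) + d₁ - 2 * e) * w₀ * w₁ * (v₀ 0 * v₁ 1 - v₀ 1 * v₁ 0) ^ 2 * x ^ (d₀ + d₁)
      + ((d₀ : ℝ) + d₂ - 2 * e) * w₀ * w₂ * (v₀ 0 * v₂ 1 - v₀ 1 * v₂ 0) ^ 2 * x ^ (d₀ + d₂)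
      + ((d₀ : ℝ) + d₃ - 2 * e) * w₀ * w₃ * (v₀ 0 * v₃ 1 - v₀ 1 * v₃ 0) ^ 2 * x ^ (d₀ + d₃)
      + ((d₁ : ℝ) + d₂ - 2 * e) * w₁ * w₂ * (v₁ 0 * v₂ 1 - v₁ 1 * v₂ 0) ^ 2 * x ^ (d₁ + d₂)
      + ((d₁ : ℝ) + d₃ - 2 * e) * w₁ * w₃ * (v₁ 0 * v₃ 1 - v₁ 1 * v₃ 0) ^ 2 * x ^ (d₁ + d₃)
      + ((d₂ : ℝ) + d₃ - 2 * e) * w₂ * w₃ * (v₂ 0 * v₃ 1 - v₂ 1 * v₃ 0) ^ 2 * x ^ (d₂ + d₃)) / x ^ (d₀ + d₁) ≤ (((d₀ : ℝ) + d₁ - 2 * e) * w₀ * w₁ * (v₀ 0 * v₁ 1 - v₀ 1 * v₁ 0) ^ 2 * y ^ (d₀ + d₁)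
      + ((d₀ : ℝ) + d₂ - 2 * e) * w₀ * w₂ * (v₀ 0 * v₂ 1 - v₀ 1 * v₂ 0) ^ 2 * y ^ (d₀ + d₂)
      + ((d₀ : ℝ) + d₃ - 2 * e) * w₀ * w₃ * (v₀ 0 * v₃ 1 - v₀ 1 * v₃ 0) ^ 2 * y ^ (d₀ + d₃)
      + ((d₁ : ℝ) + d₂ - 2 * e) * w₁ * w₂ * (v₁ 0 * v₂ 1 - v₁ 1 * v₂ 0) ^ 2 * y ^ (d₁ + d₂)
      + ((d₁ : ℝ) + d₃ - 2 * e) * w₁ * w₃ * (v₁ 0 * v₃ 1 - v₁ 1 * v₃ 0) ^ 2 * y ^ (d₁ + d₃)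
      + ((d₂ : ℝ) + d₃ - 2 * e) * w₂ * w₃ * (v₂ 0 * v₃ 1 - v₂ 1 * v₃ 0) ^ 2 * y ^ (d₂ + d₃)) / y ^ (d₀ + d₁) := by
  have hy : 0 < y := lt_of_lt_of_le hx hxy
  have q : ∀ a b : ℕ, d₀ + d₁ ≤ a + b → x ^ (a + b) / x ^ (d₀ + d₁) ≤ y ^ (a + b) / y ^ (d₀ + d₁) := by
    intro a b hab
    have key : ∀ z : ℝ, 0 < z → z ^ (a + b) / z ^ (d₀ + d₁) = z ^ (a + b - (d₀ + d₁)) := by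
      intro z hz
      have hz' : z ^ (a + b) = z ^ (d₀ + d₁) * z ^ (a + b - (d₀ + d₁)) := by rw [← pow_add]; congr 1; omega
      rw [hz', mul_div_cancel_left₀ _ (pow_pos hz _).ne']
    rw [key x hx, key y hy]
    exact pow_le_pow_left₀ hx.le hxy _
  have q0 : ∀ z : ℝ, 0 < z → z ^ (d₀ + d₁) / z ^ (d₀ + d₁) = 1 := fun z hz => div_self (pow_pos hz _).ne'
  have c01 : ((d₀ : ℝ) + d₁ - 2 * e) * w₀ * w₁ * (v₀ 0 * v₁ 1 - v₀ 1 * v₁ 0) ^ 2 ≤ 0 := by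
    have h1 : ((d₀ : ℝ) + d₁ - 2 * e) ≤ 0 := by exact_mod_cast (by omega : (d₀ : ℤ) + d₁ - 2 * e ≤ 0)
    have : ((d₀ : ℝ) + d₁ - 2 * e) * w₀ * w₁ * (v₀ 0 * v₁ 1 - v₀ 1 * v₁ 0) ^ 2
        = ((d₀ : ℝ) + d₁ - 2 * e) * (w₀ * w₁ * (v₀ 0 * v₁ 1 - v₀ 1 * v₁ 0) ^ 2) := by ring
    rw [this]; exact mul_nonpos_of_nonpos_of_nonneg h1 (by positivity)
  have cpos : ∀ (a b : ℕ) (wa wb Dsq : ℝ), 2 * e ≤ a + b → 0 ≤ wa → 0 ≤ wb → 0 ≤ Dsq →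
      0 ≤ ((a : ℝ) + b - 2 * e) * wa * wb * Dsq := by
    intro a b wa wb Dsq hab ha hb hD
    have h1 : 0 ≤ ((a : ℝ) + b - 2 * e) := by exact_mod_cast (by omega : (0 : ℤ) ≤ (a : ℤ) + b - 2 * e)
    positivity
  have c02 := cpos d₀ d₂ w₀ w₂ ((v₀ 0 * v₂ 1 - v₀ 1 * v₂ 0) ^ 2) hhi hw₀ hw₂ (sq_nonneg _)
  have c03 := cpos d₀ d₃ w₀ w₃ ((v₀ 0 * v₃ 1 - v₀ 1 * v₃ 0) ^ 2) (by omega) hw₀ hw₃ (sq_nonneg _)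
  have c12 := cpos d₁ d₂ w₁ w₂ ((v₁ 0 * v₂ 1 - v₁ 1 * v₂ 0) ^ 2) (by omega) hw₁ hw₂ (sq_nonneg _)
  have c13 := cpos d₁ d₃ w₁ w₃ ((v₁ 0 * v₃ 1 - v₁ 1 * v₃ 0) ^ 2) (by omega) hw₁ hw₃ (sq_nonneg _)
  have c23 := cpos d₂ d₃ w₂ w₃ ((v₂ 0 * v₃ 1 - v₂ 1 * v₃ 0) ^ 2) (by omega) hw₂ hw₃ (sq_nonneg _)
  rw [add_div, add_div, add_div, add_div, add_div, add_div, add_div, add_div, add_div, add_div]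
  simp only [mul_div_assoc]
  rw [q0 x hx, q0 y hy]
  have t02 := mul_le_mul_of_nonneg_left (q d₀ d₂ (by omega)) c02
  have t03 := mul_le_mul_of_nonneg_left (q d₀ d₃ (by omega)) c03
  have t12 := mul_le_mul_of_nonneg_left (q d₁ d₂ (by omega)) c12
  have t13 := mul_le_mul_of_nonneg_left (q d₁ d₃ (by omega)) c13
  have t23 := mul_le_mul_of_nonneg_left (q d₂ d₃ (by omega)) c23
  linarith

/-! ## 3. The regime law -/

/-- **REGIME LAW, decreasing side.**  `1|3` split with core upper letters, `d₀ + d₁ ≤ 2e ≤ d₀ + d₂`, `J` symmetric with `det J < 0`,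
non-negative weights, positive resolvent discriminant on `[a, b]` (`0 < a`): if `τ_e(a) ≤ 0` and `π_e(b) < 0`, then the resolvent profile
`R/x^e` is strictly decreasing on `[a, b]`. [this file + `…PivotResolventSlope`] -/
theorem resolventProfile_strictAntiOn_of_ends (e d₀ d₁ d₂ d₃ : ℕ) (h0e : d₀ < e) (he1 : e < d₁) (h12 : d₁ ≤ d₂) (h23 : d₂ ≤ d₃)
    (hlo : d₀ + d₁ ≤ 2 * e) (hhi : 2 * e ≤ d₀ + d₂) (J : Matrix (Fin 2) (Fin 2) ℝ) (hdJ : J 0 0 * J 1 1 - J 0 1 ^ 2 < 0)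
    (v₀ v₁ v₂ v₃ : Fin 2 → ℝ) (w₀ w₁ w₂ w₃ : ℝ) (hw₀ : 0 ≤ w₀) (hw₁ : 0 ≤ w₁) (hw₂ : 0 ≤ w₂) (hw₃ : 0 ≤ w₃)
    (hm₁ : J 0 0 * v₁ 1 ^ 2 - 2 * J 0 1 * (v₁ 0 * v₁ 1) + J 1 1 * v₁ 0 ^ 2 ≤ 0)
    (hm₂ : J 0 0 * v₂ 1 ^ 2 - 2 * J 0 1 * (v₂ 0 * v₂ 1) + J 1 1 * v₂ 0 ^ 2 ≤ 0)
    (hm₃ : J 0 0 * v₃ 1 ^ 2 - 2 * J 0 1 * (v₃ 0 * v₃ 1) + J 1 1 * v₃ 0 ^ 2 ≤ 0)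
    (𝔄 𝔘 ℭ τ π : ℝ[X])
    (h𝔄 : 𝔄 = Polynomial.C (w₀ * v₀ 0 ^ 2) * X ^ d₀ + Polynomial.C (w₁ * v₁ 0 ^ 2) * X ^ d₁ + Polynomial.C (w₂ * v₂ 0 ^ 2) * X ^ d₂
      + Polynomial.C (w₃ * v₃ 0 ^ 2) * X ^ d₃)
    (h𝔘 : 𝔘 = Polynomial.C (w₀ * (v₀ 0 * v₀ 1)) * X ^ d₀ + Polynomial.C (w₁ * (v₁ 0 * v₁ 1)) * X ^ d₁
      + Polynomial.C (w₂ * (v₂ 0 * v₂ 1)) * X ^ d₂ + Polynomial.C (w₃ * (v₃ 0 * v₃ 1)) * X ^ d₃)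
    (hℭ : ℭ = Polynomial.C (w₀ * v₀ 1 ^ 2) * X ^ d₀ + Polynomial.C (w₁ * v₁ 1 ^ 2) * X ^ d₁ + Polynomial.C (w₂ * v₂ 1 ^ 2) * X ^ d₂
      + Polynomial.C (w₃ * v₃ 1 ^ 2) * X ^ d₃)
    (hτ : τ = Polynomial.C (J 0 0) * ℭ - Polynomial.C (2 * J 0 1) * 𝔘 + Polynomial.C (J 1 1) * 𝔄)
    (hπ : π = 𝔄 * ℭ - 𝔘 ^ 2) (a b : ℝ) (ha : 0 < a) (hab : a ≤ b)
    (hdisc : ∀ x ∈ Icc a b, 0 < (τ.eval x) ^ 2 + 4 * (J 0 1 ^ 2 - J 0 0 * J 1 1) * π.eval x)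
    (hτa : a * τ.derivative.eval a - e * τ.eval a ≤ 0) (hπb : b * π.derivative.eval b - 2 * e * π.eval b < 0) :
    StrictAntiOn (fun y => ((τ.eval y + Real.sqrt ((τ.eval y) ^ 2 + 4 * (J 0 1 ^ 2 - J 0 0 * J 1 1) * π.eval y)) / (2 * (J 0 1 ^ 2 - J 0 0 * J 1 1))) / y ^ e) (Icc a b) := by
  have hδ : 0 < J 0 1 ^ 2 - J 0 0 * J 1 1 := by linarith
  have hπeval : ∀ x, π.eval x = (w₀ * x ^ d₀ * v₀ 0 ^ 2 + w₁ * x ^ d₁ * v₁ 0 ^ 2 + w₂ * x ^ d₂ * v₂ 0 ^ 2 + w₃ * x ^ d₃ * v₃ 0 ^ 2) * (w₀ * x ^ d₀ * v₀ 1 ^ 2 + w₁ * x ^ d₁ * v₁ 1 ^ 2 + w₂ * x ^ d₂ * v₂ 1 ^ 2 + w₃ * x ^ d₃ * v₃ 1 ^ 2) - (w₀ * x ^ d₀ * (v₀ 0 * v₀ 1) + w₁ * x ^ d₁ * (v₁ 0 * v₁ 1) + w₂ * x ^ d₂ * (v₂ 0 * v₂ 1) + w₃ * x ^ d₃ * (v₃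 0 * v₃ 1)) ^ 2 := by
    intro x
    rw [hπ, eval_sub, eval_mul, eval_pow, h𝔄, h𝔘, hℭ, eval_fourNomial, eval_fourNomial, eval_fourNomial]
    ring
  refine resolventProfile_strictAntiOn (J 0 1 ^ 2 - J 0 0 * J 1 1) e τ π hδ a b ha ?_ hdisc ?_ ?_
  · intro x hx
    rw [hπeval]
    exact pairDet_nonneg d₀ d₁ d₂ d₃ v₀ v₁ v₂ v₃ w₀ w₁ w₂ w₃ x hw₀ hw₁ hw₂ hw₃ (lt_of_lt_of_le ha hx.1)
  · intro x hx
    have hxa : a ≤ x := hx.1.le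
    have hx0 : 0 < x := ha.trans hx.1
    have hmono := tiltTrace_div_antitone e d₀ d₁ d₂ d₃ h0e he1 h12 h23 J v₀ v₁ v₂ v₃ w₀ w₁ w₂ w₃ hw₁ hw₂ hw₃ hm₁ hm₂ hm₃ a x ha hxa
    rw [← eval_tiltTrace e d₀ d₁ d₂ d₃ J v₀ v₁ v₂ v₃ w₀ w₁ w₂ w₃ 𝔄 𝔘 ℭ τ π h𝔄 h𝔘 hℭ hτ hπ a,
      ← eval_tiltTrace e d₀ d₁ d₂ d₃ J v₀ v₁ v₂ v₃ w₀ w₁ w₂ w₃ 𝔄 𝔘 ℭ τ π h𝔄 h𝔘 hℭ hτ hπ x] at hmono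
    have h1 : (a * τ.derivative.eval a - e * τ.eval a) / a ^ d₀ ≤ 0 := div_nonpos_of_nonpos_of_nonneg hτa (pow_pos ha _).le
    have h2 : (x * τ.derivative.eval x - e * τ.eval x) / x ^ d₀ ≤ 0 := hmono.trans h1
    exact (div_nonpos_iff.1 h2).elim (fun h => h.2.antisymm (pow_pos hx0 _).le ▸ h.1 |> fun _ => by
      rcases h with ⟨h3, h4⟩
      have : x ^ d₀ = 0 := le_antisymm h4 (pow_pos hx0 _).le
      exact absurd this (pow_pos hx0 _).ne') (fun h => h.1)
  · intro x hx
    have hxb : x ≤ b := hx.2.le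
    have hx0 : 0 < x := ha.trans hx.1
    have hmono := tiltPair_div_mono e d₀ d₁ d₂ d₃ (by omega) h12 h23 hlo hhi v₀ v₁ v₂ v₃ w₀ w₁ w₂ w₃ hw₀ hw₁ hw₂ hw₃ x b hx0 hxb
    rw [← eval_tiltPair e d₀ d₁ d₂ d₃ J v₀ v₁ v₂ v₃ w₀ w₁ w₂ w₃ 𝔄 𝔘 ℭ τ π h𝔄 h𝔘 hℭ hτ hπ x,
      ← eval_tiltPair e d₀ d₁ d₂ d₃ J v₀ v₁ v₂ v₃ w₀ w₁ w₂ w₃ 𝔄 𝔘 ℭ τ π h𝔄 h𝔘 hℭ hτ hπ b] at hmono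
    have h1 : (b * π.derivative.eval b - 2 * e * π.eval b) / b ^ (d₀ + d₁) < 0 :=
      div_neg_of_neg_of_pos hπb (pow_pos (ha.trans_le hab) _)
    have h2 : (x * π.derivative.eval x - 2 * e * π.eval x) / x ^ (d₀ + d₁) < 0 := lt_of_le_of_lt hmono h1
    exact (div_neg_iff.1 h2).elim (fun h => absurd h.2 (not_lt.2 (pow_pos hx0 _).le)) (fun h => h.1)

/-- **REGIME LAW, increasing side.**  Same setting: if `π_e(a) > 0` and `τ_e(b) ≥ 0`, the resolvent profile is strictly increasing on `[a, b]`.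
[this file + `…PivotResolventSlope`] -/
theorem resolventProfile_strictMonoOn_of_ends (e d₀ d₁ d₂ d₃ : ℕ) (h0e : d₀ < e) (he1 : e < d₁) (h12 : d₁ ≤ d₂) (h23 : d₂ ≤ d₃)
    (hlo : d₀ + d₁ ≤ 2 * e) (hhi : 2 * e ≤ d₀ + d₂) (J : Matrix (Fin 2) (Fin 2) ℝ) (hdJ : J 0 0 * J 1 1 - J 0 1 ^ 2 < 0)
    (v₀ v₁ v₂ v₃ : Fin 2 → ℝ) (w₀ w₁ w₂ w₃ : ℝ) (hw₀ : 0 ≤ w₀) (hw₁ : 0 ≤ w₁) (hw₂ : 0 ≤ w₂) (hw₃ : 0 ≤ w₃)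
    (hm₁ : J 0 0 * v₁ 1 ^ 2 - 2 * J 0 1 * (v₁ 0 * v₁ 1) + J 1 1 * v₁ 0 ^ 2 ≤ 0)
    (hm₂ : J 0 0 * v₂ 1 ^ 2 - 2 * J 0 1 * (v₂ 0 * v₂ 1) + J 1 1 * v₂ 0 ^ 2 ≤ 0)
    (hm₃ : J 0 0 * v₃ 1 ^ 2 - 2 * J 0 1 * (v₃ 0 * v₃ 1) + J 1 1 * v₃ 0 ^ 2 ≤ 0)
    (𝔄 𝔘 ℭ τ π : ℝ[X])
    (h𝔄 : 𝔄 = Polynomial.C (w₀ * v₀ 0 ^ 2) * X ^ d₀ + Polynomial.C (w₁ * v₁ 0 ^ 2) * X ^ d₁ + Polynomial.C (w₂ * v₂ 0 ^ 2) * X ^ d₂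
      + Polynomial.C (w₃ * v₃ 0 ^ 2) * X ^ d₃)
    (h𝔘 : 𝔘 = Polynomial.C (w₀ * (v₀ 0 * v₀ 1)) * X ^ d₀ + Polynomial.C (w₁ * (v₁ 0 * v₁ 1)) * X ^ d₁
      + Polynomial.C (w₂ * (v₂ 0 * v₂ 1)) * X ^ d₂ + Polynomial.C (w₃ * (v₃ 0 * v₃ 1)) * X ^ d₃)
    (hℭ : ℭ = Polynomial.C (w₀ * v₀ 1 ^ 2) * X ^ d₀ + Polynomial.C (w₁ * v₁ 1 ^ 2) * X ^ d₁ + Polynomial.C (w₂ * v₂ 1 ^ 2) * X ^ d₂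
      + Polynomial.C (w₃ * v₃ 1 ^ 2) * X ^ d₃)
    (hτ : τ = Polynomial.C (J 0 0) * ℭ - Polynomial.C (2 * J 0 1) * 𝔘 + Polynomial.C (J 1 1) * 𝔄)
    (hπ : π = 𝔄 * ℭ - 𝔘 ^ 2) (a b : ℝ) (ha : 0 < a) (hab : a ≤ b)
    (hdisc : ∀ x ∈ Icc a b, 0 < (τ.eval x) ^ 2 + 4 * (J 0 1 ^ 2 - J 0 0 * J 1 1) * π.eval x)
    (hπa : 0 < a * π.derivative.eval a - 2 * e * π.eval a) (hτb : 0 ≤ b * τ.derivative.eval b - e * τ.eval b) :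
    StrictMonoOn (fun y => ((τ.eval y + Real.sqrt ((τ.eval y) ^ 2 + 4 * (J 0 1 ^ 2 - J 0 0 * J 1 1) * π.eval y)) / (2 * (J 0 1 ^ 2 - J 0 0 * J 1 1))) / y ^ e) (Icc a b) := by
  have hδ : 0 < J 0 1 ^ 2 - J 0 0 * J 1 1 := by linarith
  have hπeval : ∀ x, π.eval x = (w₀ * x ^ d₀ * v₀ 0 ^ 2 + w₁ * x ^ d₁ * v₁ 0 ^ 2 + w₂ * x ^ d₂ * v₂ 0 ^ 2 + w₃ * x ^ d₃ * v₃ 0 ^ 2) * (w₀ * x ^ d₀ * v₀ 1 ^ 2 + w₁ * x ^ d₁ * v₁ 1 ^ 2 + w₂ * x ^ d₂ * v₂ 1 ^ 2 + w₃ * x ^ d₃ * v₃ 1 ^ 2) - (w₀ * x ^ d₀ * (v₀ 0 * v₀ 1) + w₁ * x ^ d₁ * (v₁ 0 * v₁ 1) + w₂ * x ^ d₂ * (v₂ 0 * v₂ 1) + w₃ * x ^ d₃ * (v₃ 0 * v₃ 1)) ^ 2 := by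
    intro x
    rw [hπ, eval_sub, eval_mul, eval_pow, h𝔄, h𝔘, hℭ, eval_fourNomial, eval_fourNomial, eval_fourNomial]
    ring
  refine resolventProfile_strictMonoOn (J 0 1 ^ 2 - J 0 0 * J 1 1) e τ π hδ a b ha ?_ hdisc ?_ ?_
  · intro x hx
    rw [hπeval]
    exact pairDet_nonneg d₀ d₁ d₂ d₃ v₀ v₁ v₂ v₃ w₀ w₁ w₂ w₃ x hw₀ hw₁ hw₂ hw₃ (lt_of_lt_of_le ha hx.1)
  · intro x hx
    have hxb : x ≤ b := hx.2.le
    have hx0 : 0 < x := ha.trans hx.1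
    have hb0 : 0 < b := ha.trans_le hab
    have hmono := tiltTrace_div_antitone e d₀ d₁ d₂ d₃ h0e he1 h12 h23 J v₀ v₁ v₂ v₃ w₀ w₁ w₂ w₃ hw₁ hw₂ hw₃ hm₁ hm₂ hm₃ x b hx0 hxb
    rw [← eval_tiltTrace e d₀ d₁ d₂ d₃ J v₀ v₁ v₂ v₃ w₀ w₁ w₂ w₃ 𝔄 𝔘 ℭ τ π h𝔄 h𝔘 hℭ hτ hπ x,
      ← eval_tiltTrace e d₀ d₁ d₂ d₃ J v₀ v₁ v₂ v₃ w₀ w₁ w₂ w₃ 𝔄 𝔘 ℭ τ π h𝔄 h𝔘 hℭ hτ hπ b] at hmono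
    have h1 : 0 ≤ (b * τ.derivative.eval b - e * τ.eval b) / b ^ d₀ := div_nonneg hτb (pow_pos hb0 _).le
    have h2 : 0 ≤ (x * τ.derivative.eval x - e * τ.eval x) / x ^ d₀ := h1.trans hmono
    exact (div_nonneg_iff.1 h2).elim (fun h => h.1) (fun h => by
      have : x ^ d₀ = 0 := le_antisymm h.2 (pow_pos hx0 _).le
      exact absurd this (pow_pos hx0 _).ne')
  · intro x hx
    have hxa : a ≤ x := hx.1.le
    have hx0 : 0 < x := ha.trans hx.1
    have hmono := tiltPair_div_mono e d₀ d₁ d₂ d₃ (by omega) h12 h23 hlo hhi v₀ v₁ v₂ v₃ w₀ w₁ w₂ w₃ hw₀ hw₁ hw₂ hw₃ a x ha hxa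
    rw [← eval_tiltPair e d₀ d₁ d₂ d₃ J v₀ v₁ v₂ v₃ w₀ w₁ w₂ w₃ 𝔄 𝔘 ℭ τ π h𝔄 h𝔘 hℭ hτ hπ a,
      ← eval_tiltPair e d₀ d₁ d₂ d₃ J v₀ v₁ v₂ v₃ w₀ w₁ w₂ w₃ 𝔄 𝔘 ℭ τ π h𝔄 h𝔘 hℭ hτ hπ x] at hmono
    have h1 : 0 < (a * π.derivative.eval a - 2 * e * π.eval a) / a ^ (d₀ + d₁) := div_pos hπa (pow_pos ha _)
    have h2 : 0 < (x * π.derivative.eval x - 2 * e * π.eval x) / x ^ (d₀ + d₁) := lt_of_lt_of_le h1 hmono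
    exact (div_pos_iff.1 h2).elim (fun h => h.1) (fun h => absurd h.2 (not_lt.2 (pow_pos hx0 _).le))

end Summit.ValiantsHypothesis.ValiantsHypothesis.Theorems.LacunarySymmetroidMatrixDescartes.Pivot.Resolvent
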